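import Summits.HodgeConjecture.HodgeConjecture.Theorems.F0P6bTorsionTower
import Literature.AlgebraicGeometry.GroupSchemes.BarsottiTateGroupBaseChange
import Literature.AlgebraicGeometry.GroupSchemes.BarsottiTateGroupHom
import Literature.AlgebraicGeometry.AbelianSchemes.FinsetInAffineOpenOfArtinianBase
import Literature.AlgebraicGeometry.AbelianSchemes.SerreTateCanonicalLiftFiniteSource
import Literature.AlgebraicGeometry.GroupSchemes.ReductionKernelKilledByNSquare
import Literature.AlgebraicGeometry.GroupSchemes.CartierDualQuotient
import Literature.AlgebraicGeometry.GroupSchemes.CartierDualDoubleAnnihilator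
import Literature.AlgebraicGeometry.GroupSchemes.CartierDualQuotientArtinianKernel
import Literature.AlgebraicGeometry.GroupSchemes.SubPinCompCoverClosedImmersion
import Literature.AlgebraicGeometry.AbelianSchemes.IsMonHomOfCompFaithfullyFlat
import Literature.AlgebraicGeometry.Morphisms.FpqcDescentOfMorphisms
import Literature.AlgebraicGeometry.Morphisms.FiniteBaseChangeAffine
import Literature.AlgebraicGeometry.AbelianSchemes.PDivisibleGroupOfAbelianScheme
import Literature.AlgebraicGeometry.Morphisms.ClosedImmersionOfEqualRank
import Literature.AlgebraicGeometry.GroupSchemes.SerreTateStabilisationTrivialKernel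
import Literature.AlgebraicGeometry.GroupSchemes.BarsottiTateGroupQuotientMapsDescent
import Literature.AlgebraicGeometry.AbelianSchemes.SerreTateQuotientReductionSquare
import Literature.AlgebraicGeometry.AbelianSchemes.SerreTateQuotientReductionKernel
import Literature.AlgebraicGeometry.AbelianSchemes.AbelianSchemeHomDescentKernelEq
import Literature.AlgebraicGeometry.AbelianSchemes.AbelianSchemeOverLevelBaseChange
import Literature.AlgebraicGeometry.AbelianSchemes.AbelianSchemeOverFibreIdentity
import Literature.AlgebraicGeometry.AbelianSchemes.AbelianSchemeOverMulNFiniteFlat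
import Literature.AlgebraicGeometry.AbelianSchemes.AbelianSchemeOverHomNoetherianAnyBase
import Literature.AlgebraicGeometry.AbelianSchemes.AbelianSchemeQuotientMulNDescent
import Literature.AlgebraicGeometry.GroupSchemes.SerreTateKernelFlatCover
import Literature.AlgebraicGeometry.GroupSchemes.GroupSchemeKernel
import Literature.AlgebraicGeometry.Morphisms.FlatOfComp
import Literature.AlgebraicGeometry.GroupSchemes.SerreTateDelta2OfLocalLift
import Literature.AlgebraicGeometry.GroupSchemes.BarsottiTateGroupTranslationCover
import Literature.AlgebraicGeometry.GroupSchemes.UnitComponentThickeningLift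
import Literature.AlgebraicGeometry.GroupSchemes.AffineSubtowerGlobalSections
import Literature.AlgebraicGeometry.GroupSchemes.BarsottiTateGroupUnitComponentTower
import Literature.RingTheory.AdicTopology.PowerSeriesTowerPresentation
import Literature.RingTheory.AdicTopology.SpecialFibreQuotientTransport
import Literature.AlgebraicGeometry.AbelianSchemes.SerreTateSpecialFibrePsiDatum
import Literature.AlgebraicGeometry.GroupSchemes.UnitComponentSpecialFibreStalk
import Literature.AlgebraicGeometry.GroupSchemes.UnitComponentTowerSpecialFibre
import Literature.AlgebraicGeometry.GroupSchemes.UnitComponentTowerSpecialFibreTheta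
import HarnessLib
import HarnessLib.Audit.LibrarySuggestionsDenyListCruxes

/-!
# F0 · P6b — ★ RE-HOME TWIN of the sub-line «SERRE–TATE σ2», PART 2∕3: the organs E2b (image of `β₂` = quotient by the flat kernel) and E3 (torsion tower of the quotient)

HC_CM is proved only modulo the printed citations until rung 0 closes; this twin changes no count (count-neutral ★ on
`--supports stmt-HodgeConjecture-24832`).  Every statement and proof body below is copied VERBATIM from the crux workfile
`Cruxes/HLiu418/Lines/F0_P6b_SerreTateSigma2.lean` ED. 5 (commit 18dc629bc214, sha16 1b5126d83441851a; full history in its module docstring);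
ONLY the namespace (`…Cruxes.HLiu418.F0P6bSigma2`, shared by the three parts), the sibling imports (`Lines.F0_P6b_*` ↦ `Theorems.F0P6b*`) and the
qualified sibling names are renamed, and the 868-line file is SPLIT IN THREE to meet the 400-line Theorems lint (desk F0P6b-plan (g14), LEAD «M-153u»).
Sorry-free; axioms of every theorem = [propext, Classical.choice, Quot.sound].

Content of this part: §E2b `stub_L4B1esZ_imageOfFlatKernel` (with its sorry-free helpers `existsUnique_desc_of_pointConstant`,
`mono_of_forall_comp_eq`) — the image of `β₂` is the quotient `B[p²] ⧸ K`, a finite flat closed subgroup `Z` of `Y`; §E3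
`stub_L4B1esT_torsionTowerOfQuotient` (helper `mono_of_trivialKernel`) — the quotient `X = Y ⧸ Z` has `p`-divisible group `B`.
Part 1∕3 = `Theorems/F0P6bSigma2Kernel.lean`; part 3∕3 = `Theorems/F0P6bSigma2.lean`.
-/

noncomputable section

set_option autoImplicit false
set_option linter.dupNamespace false

open CategoryTheory CategoryTheory.Limits AlgebraicGeometry MonoidalCategory CartesianMonoidalCategory IsLocalRing
open scoped MonObj

namespace Summit.HodgeConjecture.HodgeConjecture.Cruxes.HLiu418.F0P6bSigma2

open Literature.AlgebraicGeometry.GroupSchemes Literature.AlgebraicGeometry.AbelianSchemes Literature.AlgebraicGeometry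

/-! ## §E2b The image of `β₂` = the quotient `B[p²] ⧸ K`, a finite flat closed subgroup of `Y` -/

section E2bPaid
/-! ### ED. 3′: sorry-free helpers for the payment of E2b (moved from the desk's `Sigma2ImageQuot` cand dfae2a4261ab78b9, §0) -/

open Literature.AlgebraicGeometry.Motives (SchemeOver)
open Literature.AlgebraicGeometry.GroupSchemes.AffineGroupScheme GroupSchemeKernel

/-- **Descent along an fpqc cover, `T`-point form**: a morphism `f : W → X` over `Spec A` that is constant on the fibres of a flat surjective
quasi-compact `q : W → Q` (tested on pairs of `T`-points) descends uniquely along `q` (★ `SchemeOver.existsUnique_desc_of_pullback_comp_eq` on the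
kernel pair). [cite: GortzWedhorn2020, Thm. 14.72] -/
theorem existsUnique_desc_of_pointConstant {A : Type} [CommRing A] {W Q X : Over (Spec (.of A))} (q : W ⟶ Q)
    [Flat q.left] [Surjective q.left] [QuasiCompact q.left] (f : W ⟶ X)
    (hf : ∀ (T : Over (Spec (.of A))) (a b : T ⟶ W), a ≫ q = b ≫ q → a ≫ f = b ≫ f) :
    ∃! g : Q ⟶ X, q ≫ g = f := by
  have hh : pullback.fst q.left q.left ≫ f.left = pullback.snd q.left q.left ≫ f.left := by
    have hw : pullback.snd q.left q.left ≫ W.hom = (pullback.fst q.left q.left ≫ W.hom : _ ⟶ Spec (.of A)) := by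
      rw [← Over.w q, ← Category.assoc, ← pullback.condition, Category.assoc]
    let T : Over (Spec (.of A)) := Over.mk (pullback.fst q.left q.left ≫ W.hom)
    let a : T ⟶ W := Over.homMk (pullback.fst q.left q.left) rfl
    let b : T ⟶ W := Over.homMk (pullback.snd q.left q.left) hw
    have hab : a ≫ q = b ≫ q := Over.OverMorphism.ext pullback.condition
    exact congrArg (fun φ => φ.left) (hf T a b hab)
  exact Literature.AlgebraicGeometry.Morphisms.SchemeOver.existsUnique_desc_of_pullback_comp_eq q f hh

/-- **A homomorphism with trivial kernel out of the target of an fpqc homomorphism-cover is a monomorphism**: `q : G → Q` flat surjective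
quasi-compact, `i : Q → Y` with `(a ≫ q) ≫ i = (b ≫ q) ≫ i → a ≫ q = b ≫ q` for all `T`-points `a b` of `G` ⇒ `Mono i` (test on the fpqc-local
lifts of two `T`-points of `Q` through `G ×_Q T`). [cite: GortzWedhorn2020, Thm. 14.72] -/
theorem mono_of_forall_comp_eq {A : Type} [CommRing A] {G Q Y : Over (Spec (.of A))} (q : G ⟶ Q)
    [Flat q.left] [Surjective q.left] [QuasiCompact q.left] (i : Q ⟶ Y)
    (h : ∀ (T : Over (Spec (.of A))) (x y : T ⟶ Q), x ≫ i = y ≫ i →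
      ∀ (T' : Over (Spec (.of A))) (t : T' ⟶ T) (a : T' ⟶ G), a ≫ q = t ≫ x → t ≫ x = t ≫ y) :
    Mono i where
  right_cancellation {T} x y hxy := by
    -- pull the cover `q` back along `x`: `T' := G ×_Q T → T` is again fpqc, and over it `x` lifts to `G`
    have hw : pullback.snd q.left x.left ≫ T.hom = (pullback.fst q.left x.left ≫ G.hom : _ ⟶ Spec (.of A)) := by
      rw [← Over.w x, ← Category.assoc, ← pullback.condition, Category.assoc, Over.w q]
    let T' : Over (Spec (.of A)) := Over.mk (pullback.fst q.left x.left ≫ G.hom)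
    let a : T' ⟶ G := Over.homMk (pullback.fst q.left x.left) rfl
    let t : T' ⟶ T := Over.homMk (pullback.snd q.left x.left) hw
    have hat : a ≫ q = t ≫ x := Over.OverMorphism.ext pullback.condition
    have key : t ≫ x = t ≫ y := h T x y hxy T' t a hat
    haveI : Flat t.left := by change Flat (pullback.snd q.left x.left); infer_instance
    haveI : Surjective t.left := by change Surjective (pullback.snd q.left x.left); infer_instance
    haveI : QuasiCompact t.left := by change QuasiCompact (pullback.snd q.left x.left); infer_instance
    exact Literature.AlgebraicGeometry.Morphisms.SchemeOver.hom_ext_of_fpqc t key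

/-- **stub E2b «IMAGE = FINITE FLAT QUOTIENT» (the affine case of [SGA3I] Exp. V Thm. 4.1 ∕ [GortzWedhorn2023] Thm. 27.68 ∕ [MumfordAV1970] §12
Thm. 1: quotient of a finite locally free group scheme by a finite locally free subgroup).**  In the setting of E1–E2a: the homomorphism
`β 2 : B[p²] → Y` from the FINITE FLAT `B[p²]` with FINITE FLAT kernel `K` FACTORS as a faithfully flat `b : B[p²] ↠ Z` (flat and surjective)
followed by a closed immersion `iZ : Z ↪ Y`, with `Z` (`= B[p²] ⧸ K`, the schematic image) FINITE FLAT over `A` and a SUBGROUP of `Y` — unit,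
multiplication and inversion of `Y` restrict to `Z`, stated as factorings (the currency of `stub_L4B1uQ_quotientByFiniteFlatSubgroup`).
Road (M–L): `𝒪(Z) :=` the equaliser of the two coaction maps `𝒪(B[p²]) ⇉ 𝒪(B[p²]) ⊗ 𝒪(K)` (invariants), finite flat of rank `p^{4g} ⁄ rk K`
with `B[p²] → Z` faithfully flat ([MumfordAV1970] §12 Thm. 1 (B)); `Z → Y` is a proper monomorphism, hence a closed immersion (Mathlib
`isClosedImmersion_iff_isProperMap_and_mono`-type lemma); the factorings by fppf descent along `b` (★ `GroupSchemes/QuotientMaps`).  Why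
it might fail: only Lean cost (no finite-group-SCHEME quotient is ★ yet: the tree's `RelativeSpec/FiniteGroupQuotient*` are for constant groups).
[cite: SGA3I, Exp. V Thm. 4.1] [cite: GortzWedhorn2023, Thm. 27.68 and Prop. 27.62] [cite: MumfordAV1970, §12 Thm. 1 (p. 111)] -/
theorem stub_L4B1esZ_imageOfFlatKernel :
    ∀ (p : ℕ), p.Prime → ∀ (A : Type) [CommRing A] [IsArtinianRing A] [IsLocalRing A], IsNilpotent (p : A) →
      ∀ (J : Ideal A), J ≠ ⊤ → maximalIdeal A * J = ⊥ →
      ∀ (g : ℕ) (X₀ : AbelianSchemeOver (Spec (.of (A ⧸ J)))), X₀.IsOfRelDim g →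
      ∀ (B₀ : BTGroup (Spec (.of (A ⧸ J))) p (2 * g)) (i₀ : ∀ n, B₀.G n ⟶ X₀.X), F0P6bTorsionTower.IsTorsionTower X₀ B₀ i₀ →
      ∀ (B : BTGroup (Spec (.of A)) p (2 * g)) (c : ∀ n, (B₀.G n).left ⟶ (B.G n).left),
        B₀.IsBaseChangeVia B (Spec.map (CommRingCat.ofHom (Ideal.Quotient.mk J))) c →
      ∀ (Y : AbelianSchemeOver (Spec (.of A))), Y.IsOfRelDim g → ∀ (GY : X₀.X.left ⟶ Y.X.left),
        X₀.IsBaseChangeVia Y (Spec.map (CommRingCat.ofHom (Ideal.Quotient.mk J))) GY →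
      ∀ (β : ∀ n, B.G n ⟶ Y.X), (∀ n, letI := B.grpObj n; IsMonHom (β n)) → (∀ n, B.incl n ≫ β (n + 1) = β n) →
        (∀ n, c n ≫ (β n).left = ((i₀ n) ^ p).left ≫ GY) →
      ∀ (K : Over (Spec (.of A))) (iK : K ⟶ B.G 2), IsClosedImmersion iK.left → IsFinite K.hom → Flat K.hom →
        (∀ (T : Over (Spec (.of A))) (u : T ⟶ B.G 2), u ≫ β 2 = 1 ↔ ∃ v : T ⟶ K, v ≫ iK = u) →
        ∃ (Z : Over (Spec (.of A))) (iZ : Z ⟶ Y.X) (b : B.G 2 ⟶ Z), IsClosedImmersion iZ.left ∧ IsFinite Z.hom ∧ Flat Z.hom ∧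
          b ≫ iZ = β 2 ∧ Flat b.left ∧ Surjective b.left ∧
          (∃ e : 𝟙_ (Over (Spec (.of A))) ⟶ Z, e ≫ iZ = 1) ∧
          (∃ m : Z ⊗ Z ⟶ Z, m ≫ iZ = (fst Z Z ≫ iZ) * (snd Z Z ≫ iZ)) ∧
          (∃ n : Z ⟶ Z, n ≫ iZ = iZ⁻¹) := by
  -- ED. 3′: PAID BY ★ TERMS (Cartier–Tate quotient over the Artinian local base; p853882 + p853887, deal P6b-A3 «L2» LA2-p03 (g9))
  intro p hp A _ _ _ hpA J hJ hmJ g X₀ hX₀ B₀ i₀ hi₀ B c hc Y hY GY hGY β hβ hβincl hβc K iK hKci hKfin hKflat hker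
  letI := B.grpObj 2
  letI := B.comm 2
  haveI := hβ 2
  -- `G := B[p²]` is a finite free commutative affine group object over the Artinian local `A`
  haveI : IsFinite (B.G 2).hom := B.isFinite 2
  haveI : Flat (B.G 2).hom := B.flat 2
  haveI : IsAffine (B.G 2).left := isAffine_of_isAffineHom (B.G 2).hom
  haveI : Module.Finite A (Alg (B.G 2)) := Alg.moduleFinite (B.G 2)
  haveI : Module.Free A (Alg (B.G 2)) := Literature.AlgebraicGeometry.Morphisms.moduleFree_sections (B.G 2).hom
  -- `H := ker (β 2)`, a closed subgroup, finite; FLAT because isomorphic to `K`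
  have hiKβ : iK ≫ β 2 = 1 := (hker K iK).2 ⟨𝟙 K, Category.id_comp _⟩
  haveI : IsProper Y.X.hom := Y.isProper
  haveI : IsClosedImmersion (kerι (β 2)).left := isClosedImmersion_kerι_left_of_isSeparated (β 2)
  haveI : IsCommMonObj (ker (β 2)) := isCommMonObj_ker (β 2)
  have hkerhom : (kerι (β 2)).left ≫ (B.G 2).hom = (ker (β 2)).hom := Over.w (kerι (β 2))
  haveI : IsFinite (ker (β 2)).hom := by rw [← hkerhom]; infer_instance
  haveI : IsAffine (ker (β 2)).left := isAffine_of_isAffineHom (ker (β 2)).hom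
  haveI : Module.Finite A (Alg (ker (β 2))) := Alg.moduleFinite (ker (β 2))
  -- the comparison `K ≅ ker (β 2)`
  obtain ⟨v, hv⟩ := (hker (ker (β 2)) (kerι (β 2))).1 (kerι_comp (β 2))
  let e : K ⟶ ker (β 2) := kerLift iK hiKβ
  have he : e ≫ kerι (β 2) = iK := kerLift_ι iK hiKβ
  haveI : Mono iK := by
    haveI : Mono iK.left := inferInstance
    exact Over.mono_of_mono_left iK
  have hve : v ≫ e = 𝟙 _ := ker_hom_ext (by rw [Category.assoc, he, hv, Category.id_comp])
  have hev : e ≫ v = 𝟙 _ := (cancel_mono iK).1 (by rw [Category.assoc, hv, he, Category.id_comp])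
  haveI : IsIso v := ⟨⟨e, hve, hev⟩⟩
  haveI : Flat (ker (β 2)).hom := by
    rw [← Over.w v]
    haveI : IsIso v.left := (inferInstance : IsIso ((Over.forget _).map v))
    infer_instance
  haveI : Module.Free A (Alg (ker (β 2))) := Literature.AlgebraicGeometry.Morphisms.moduleFree_sections (ker (β 2)).hom
  -- the Cartier–Tate quotient `Z := B[p²] ⧸ ker (β 2)` and `b := quotProj`
  set j : ker (β 2) ⟶ B.G 2 := kerι (β 2) with hj
  haveI : IsMonHom j := GroupSchemeKernel.isMonHom_kerι (β 2)
  haveI : IsClosedImmersion j.left := by rw [hj]; infer_instance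
  haveI : Module.Free A (Alg (annihilator j)) := free_alg_annihilator_of_isArtinianRing A (ker (β 2)) (B.G 2) j
  obtain ⟨hflat, hsurj, hkerq⟩ := quotProj_flat_surjective_ker_of_isArtinianRing A (ker (β 2)) (B.G 2) j
  haveI := hflat; haveI := hsurj
  haveI : QuasiCompact (quotProj j).left := inferInstance
  -- `β 2` is constant on the fibres of `quotProj j`
  have hconst : ∀ (T : Over (Spec (.of A))) (a b : T ⟶ B.G 2), a ≫ quotProj j = b ≫ quotProj j → a ≫ β 2 = b ≫ β 2 := by
    intro T a b hab
    have h1 : (a⁻¹ * b) ≫ quotProj j = 1 := by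
      rw [MonObj.mul_comp, GrpObj.inv_comp, hab, inv_mul_cancel]
    obtain ⟨w, hw⟩ := (hkerq T (a⁻¹ * b)).1 h1
    have h2 : (a⁻¹ * b) ≫ β 2 = 1 := by rw [← hw, Category.assoc, hj, kerι_comp, MonObj.comp_one]
    rw [MonObj.mul_comp, GrpObj.inv_comp, inv_mul_eq_one] at h2
    exact h2
  obtain ⟨iZ, hiZ, hiZuniq⟩ := existsUnique_desc_of_pointConstant (quotProj j) (β 2) hconst
  -- `iZ` is a homomorphism
  haveI : IsMonHom iZ := isMonHom_of_comp_of_flat_surjective (quotProj j) iZ (by rw [hiZ]; infer_instance)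
  -- `iZ` is a monomorphism: trivial kernel, tested fpqc-locally
  haveI : Mono iZ := by
    refine mono_of_forall_comp_eq (quotProj j) iZ fun T x y hxy T' t a hat => ?_
    -- over the fpqc cover `t`, lift `y` too: pull back `q` along `t ≫ y`
    have hw' : pullback.snd (quotProj j).left (t ≫ y).left ≫ T'.hom =
        (pullback.fst (quotProj j).left (t ≫ y).left ≫ (B.G 2).hom : _ ⟶ Spec (.of A)) := by
      rw [← Over.w (t ≫ y), ← Category.assoc, ← pullback.condition, Category.assoc, Over.w (quotProj j)]
    let T'' : Over (Spec (.of A)) := Over.mk (pullback.fst (quotProj j).left (t ≫ y).left ≫ (B.G 2).hom)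
    let a' : T'' ⟶ B.G 2 := Over.homMk (pullback.fst (quotProj j).left (t ≫ y).left) rfl
    let s : T'' ⟶ T' := Over.homMk (pullback.snd (quotProj j).left (t ≫ y).left) hw'
    have has : a' ≫ quotProj j = s ≫ t ≫ y := Over.OverMorphism.ext pullback.condition
    haveI : Flat s.left := by change Flat (pullback.snd (quotProj j).left (t ≫ y).left); infer_instance
    haveI : Surjective s.left := by change Surjective (pullback.snd (quotProj j).left (t ≫ y).left); infer_instance
    haveI : QuasiCompact s.left := by change QuasiCompact (pullback.snd (quotProj j).left (t ≫ y).left); infer_instance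
    apply Literature.AlgebraicGeometry.Morphisms.SchemeOver.hom_ext_of_fpqc s
    -- both `s ≫ a` and `a'` are `T''`-points of `G` with the same image under `β 2 = q ≫ iZ`
    have e1 : (s ≫ a) ≫ quotProj j = s ≫ t ≫ x := by rw [Category.assoc, hat]
    have e2 : (s ≫ a) ≫ β 2 = a' ≫ β 2 := by
      rw [← hiZ, ← Category.assoc, e1, ← Category.assoc (a'), has, Category.assoc, Category.assoc, Category.assoc, Category.assoc, hxy]
    -- same `β 2`-image ⇒ the quotient `(s ≫ a)⁻¹ * a'` dies under `β 2`, so lies in `ker (β 2)`, so dies under `q`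
    have h3 : ((s ≫ a)⁻¹ * a') ≫ β 2 = 1 := by rw [MonObj.mul_comp, GrpObj.inv_comp, e2, inv_mul_cancel]
    have h4 : ((s ≫ a)⁻¹ * a') ≫ quotProj j = 1 :=
      (hkerq T'' _).2 ⟨kerLift _ h3, by rw [hj, kerLift_ι]⟩
    rw [MonObj.mul_comp, GrpObj.inv_comp, inv_mul_eq_one] at h4
    -- `h4 : (s ≫ a) ≫ q = a' ≫ q`
    rw [← e1, h4, has]
  -- `iZ` is finite (source finite over `A`, target separated), hence a closed immersion
  haveI : IsFinite iZ.left := by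
    haveI : IsFinite (iZ.left ≫ Y.X.hom) := by rw [Over.w iZ]; infer_instance
    exact IsFinite.of_comp iZ.left Y.X.hom
  haveI : IsClosedImmersion iZ.left := IdealKernelLayerMap.isClosedImmersion_left_of_isFinite_of_mono iZ
  refine ⟨quot j, iZ, quotProj j, inferInstance, inferInstance, inferInstance, hiZ, hflat, hsurj, ?_, ?_, ?_⟩
  · exact ⟨1, MonObj.one_comp iZ⟩
  · refine ⟨fst _ _ * snd _ _, ?_⟩
    rw [MonObj.mul_comp]
  · refine ⟨(𝟙 _)⁻¹, ?_⟩
    rw [GrpObj.inv_comp, Category.id_comp]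

end E2bPaid

/-! ## §E3 The quotient `X = Y ⧸ Z` has `p`-divisible group `B` -/

section E3Paid
/-! ### ED. 3″: sorry-free helper for the payment of E3 (moved from the desk's `Sigma2TowerOfQuotient` cand 30472d535777e6e8) -/

open Literature.AlgebraicGeometry.GroupSchemes.IdealKernelLayerMap (isClosedImmersion_left_of_isFinite_of_mono)

/-- A homomorphism of group objects with trivial kernel on all `T`-points is a monomorphism. -/
theorem mono_of_trivialKernel {S : Scheme.{0}} {G H : Over S} [GrpObj G] [GrpObj H] (f : G ⟶ H) [IsMonHom f]
    (hf : ∀ (T : Over S) (u : T ⟶ G), u ≫ f = 1 → u = 1) : Mono f := by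
  refine ⟨fun {T} a₁ a₂ h => ?_⟩
  have h1 : (a₁ * a₂⁻¹) ≫ f = 1 := by
    rw [MonObj.mul_comp, GrpObj.inv_comp, h, mul_inv_cancel]
  have h2 := hf T _ h1
  calc a₁ = (a₁ * a₂⁻¹) * a₂ := by rw [inv_mul_cancel_right]
    _ = a₂ := by rw [h2, one_mul]

/-- **stub E3 «TOWER» ([Katz1981SerreTate] proof of Thm. 1.2.1: «`A[p^∞] ≅ B[p^∞]⧸K ≅ G`»; [Tate1967] §2 (2.4)).**  In the setting of
E1–E2b, let `π : Y ↠ X` be a finite flat surjective homomorphism onto an abelian `X ∕ A` of relative dimension `g` WITH KERNEL EXACTLY `Z`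
(`u ≫ π = 1 ↔ u` factors through `iZ` — the output of `stub_L4B1uQ_quotientByFiniteFlatSubgroup`).  THEN there are kernel embeddings
`iX n : B[pⁿ] ↪ X` with `IsTorsionTower X B iX` (★ parent §0: homomorphisms, `B[pⁿ] = X[pⁿ]` as a cartesian square, compatible with the
transitions), characterised as the DESCENT of `β (n+2) ≫ π` along `[p²] = pMap ∘ pMap : B[pⁿ⁺²] ↠ B[pⁿ]`.  Proof road (L): `[p²]` is
faithfully flat with kernel `B[p²]` (★ `BTGroup.flat_pMap`, `surjective_pMap`, `isPullback_incl`), and `β (n+2) ≫ π` kills `B[p²]`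
(`β (n+2) ∘ incl² = β 2 = b ≫ iZ`, `iZ ≫ π = 1`), so it descends (fppf descent of morphisms, ★ `GroupSchemes/QuotientMaps`) to a
homomorphism `iX n`, killed by `pⁿ`, hence INTO `X[pⁿ]` — finite flat of rank `p^{2gn}` (★ `PDivisibleGroupOfAbelianScheme`, `X` of relative
dimension `g`) like `B[pⁿ]` (★ `BTGroup.finrank_eq`); its KERNEL IS TRIVIAL by the STABILISATION lemma of E2a (`(β (n+2) ≫ π) w = 1 ⇒
β (n+2) w ∈ Z = Im b ⇒ w ∈ B[p²] · Ker β_{n+2} = B[p²]` — Messing-free), so it is a monomorphism, hence a closed immersion (★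
`GroupSchemes.isClosedImmersion_left_of_isFinite_of_mono`), hence an ISOMORPHISM onto `X[pⁿ]` by equal rank (★
`Morphisms.Over.isIso_of_isClosedImmersion_of_finrank_eq`); tower compatibility from `incl n ∘ [p²] = [p²] ∘ incl (n+2)`.  Why it might fail: only
by a mis-cut of the descent relation (checked on points: `iX (p² b') = π (β b')`).
[cite: Katz1981SerreTate, proof of Theorem 1.2.1 (§1.2, p. 142)] [cite: Tate1967, §2 (2.1) and (2.4)] -/
theorem stub_L4B1esT_torsionTowerOfQuotient :
    ∀ (p : ℕ), p.Prime → ∀ (A : Type) [CommRing A] [IsArtinianRing A] [IsLocalRing A], IsNilpotent (p : A) →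
      ∀ (J : Ideal A), J ≠ ⊤ → maximalIdeal A * J = ⊥ →
      ∀ (g : ℕ) (X₀ : AbelianSchemeOver (Spec (.of (A ⧸ J)))), X₀.IsOfRelDim g →
      ∀ (B₀ : BTGroup (Spec (.of (A ⧸ J))) p (2 * g)) (i₀ : ∀ n, B₀.G n ⟶ X₀.X), F0P6bTorsionTower.IsTorsionTower X₀ B₀ i₀ →
      ∀ (B : BTGroup (Spec (.of A)) p (2 * g)) (c : ∀ n, (B₀.G n).left ⟶ (B.G n).left),
        B₀.IsBaseChangeVia B (Spec.map (CommRingCat.ofHom (Ideal.Quotient.mk J))) c →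
      ∀ (Y : AbelianSchemeOver (Spec (.of A))), Y.IsOfRelDim g → ∀ (GY : X₀.X.left ⟶ Y.X.left),
        X₀.IsBaseChangeVia Y (Spec.map (CommRingCat.ofHom (Ideal.Quotient.mk J))) GY →
      ∀ (β : ∀ n, B.G n ⟶ Y.X), (∀ n, letI := B.grpObj n; IsMonHom (β n)) → (∀ n, B.incl n ≫ β (n + 1) = β n) →
        (∀ n, c n ≫ (β n).left = ((i₀ n) ^ p).left ≫ GY) →
      ∀ (Z : Over (Spec (.of A))) (iZ : Z ⟶ Y.X) (b : B.G 2 ⟶ Z), IsClosedImmersion iZ.left → IsFinite Z.hom → Flat Z.hom →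
        b ≫ iZ = β 2 → Flat b.left → Surjective b.left →
      ∀ (X : AbelianSchemeOver (Spec (.of A))), X.IsOfRelDim g → ∀ (π : Y.X ⟶ X.X), IsMonHom π → IsFinite π.left → Flat π.left →
        Surjective π.left → (∀ (T : Over (Spec (.of A))) (u : T ⟶ Y.X), u ≫ π = 1 ↔ ∃ v : T ⟶ Z, v ≫ iZ = u) →
        ∃ iX : ∀ n, B.G n ⟶ X.X, F0P6bTorsionTower.IsTorsionTower X B iX ∧
          ∀ n, B.pMap (n + 1) ≫ B.pMap n ≫ iX n = β (n + 2) ≫ π := by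
  -- ED. 3″: PAID BY ★ TERMS (descent along `[p²]` + trivial kernel + kernel recognition; p853903 + p853896, deals P6b-A4 «L1» LA1-p02 (g10) ∕ P6b-A4′ «LH10» LH10-p02 (g17))
  intro p hp A _ _ _ hpA J hJ hmJ g X₀ hX₀ B₀ i₀ hT B c hBc Y hY GY hGY β hβ₁ hβ₂ hβ₃ Z iZ b hiZ hZf hZfl hbiZ hbf hbs X hX π hπ hπf
    hπfl hπs hker
  obtain ⟨iX, hmon, hincl, hdesc, hkill⟩ :=
    BTGroup.descTower_sigma2 p hp A hpA J hJ hmJ g X₀ hX₀ B₀ i₀ hT B c hBc Y hY GY hGY β hβ₁ hβ₂ hβ₃ Z iZ b hiZ hZf hZfl hbiZ hbf hbs X hX π hπ hπf hπfl hπs hker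
  have htriv := BTGroup.trivialKernel_sigma2 p hp A hpA J hJ hmJ g X₀ hX₀ B₀ i₀ hT B c hBc Y hY GY hGY β hβ₁ hβ₂ hβ₃ Z iZ b hiZ hZf hZfl hbiZ hbf hbs X hX π hπ hπf
    hπfl hπs hker iX hmon hdesc
  refine ⟨iX, ⟨hmon, fun n => ?_, hincl⟩, hdesc⟩
  -- KERNEL RECOGNITION at level `n`
  letI := B.grpObj n
  haveI : IsMonHom (iX n) := hmon n
  have hpn : p ^ n ≠ 0 := pow_ne_zero n hp.ne_zero
  -- `iX n` is killed by `[pⁿ]`, so it factors through the `pⁿ`-torsion of `X`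
  have hkill' : iX n ≫ X.mulN (p ^ n) = 1 := by rw [AbelianSchemeOver.comp_mulN, hkill n]
  let t : B.G n ⟶ X.torsion (p ^ n) := X.torsionLift (iX n) hkill'
  have ht : t ≫ X.torsionι (p ^ n) = iX n := X.torsionLift_ι _ _
  -- `iX n` is a monomorphism (trivial kernel), hence so is `t`
  haveI : Mono (iX n) := mono_of_trivialKernel (iX n) (htriv n)
  haveI : Mono t := by rw [← ht] at *; exact mono_of_mono_fac ht
  -- finiteness of `t.left`: `t.left ≫ (X[pⁿ] → S) = (B[pⁿ] → S)` is finite and `X[pⁿ] → S` is separated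
  haveI : IsFinite (B.G n).hom := B.isFinite n
  haveI : IsFinite (X.torsion (p ^ n)).hom := X.isFinite_torsion_hom hpn
  haveI : Flat (X.torsion (p ^ n)).hom := X.flat_torsion_hom hpn
  haveI : IsFinite t.left :=
    MorphismProperty.of_postcomp (W := @IsFinite) (W' := @IsSeparated) t.left (X.torsion (p ^ n)).hom
      (inferInstance : IsSeparated (X.torsion (p ^ n)).hom) (by rw [Over.w t]; infer_instance)
  haveI : IsClosedImmersion t.left := isClosedImmersion_left_of_isFinite_of_mono t
  haveI : Flat (t.left ≫ (X.torsion (p ^ n)).hom) := by rw [Over.w t]; exact B.flat n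
  -- equal ranks `p^{2gn}` on both sides ⇒ `t.left` is an isomorphism
  haveI : IsIso t.left :=
    Morphisms.isIso_of_isClosedImmersion_of_finrank_eq t.left (X.torsion (p ^ n)).hom (fun s => by
      rw [show t.left ≫ (X.torsion (p ^ n)).hom = (B.G n).hom from Over.w t, B.finrank_eq n s,
        X.finrank_torsion_hom hX hpn s, ← pow_mul])
  haveI : IsIso t := by
    haveI : IsIso ((Over.forget _).map t) := by simpa using (inferInstance : IsIso t.left)
    exact isIso_of_reflects_iso t (Over.forget _)
  -- transport the defining cartesian square of `X[pⁿ]` along the isomorphism `t`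
  have hsq := X.isPullback_torsionι (p ^ n)
  have hmul : X.mulN (p ^ n) = (𝟙 X.X) ^ (p ^ n) := by
    rw [← Category.id_comp (X.mulN (p ^ n)), AbelianSchemeOver.comp_mulN]
  refine (IsPullback.of_iso hsq (asIso t).symm (Iso.refl _) (Iso.refl _) (Iso.refl _) ?_ ?_ ?_ ?_)
  · simp [← ht]
  · exact toUnit_unique _ _
  · simp [hmul]
  · simp

end E3Paid

end Summit.HodgeConjecture.HodgeConjecture.Cruxes.HLiu418.F0P6bSigma2
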